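import Summits.ResolutionOfSingularities.ResolutionOfSingularities.Theses.IsolatedCore
import Literature.AlgebraicGeometry.Resolution.NonReducedNoResolution

/-!
# `IsolatedResolution` — negative lemmas I: reducedness is load-bearing; the encoding is not junk-satisfiable

Support (negative) lemma for crux `stmt-ResolutionOfSingularities-18021`
(`Summit.ResolutionOfSingularities.ResolutionOfSingularities.Theses.IsolatedCore.IsolatedResolution`, "K":
for every prime `p`, every field `k` of characteristic `p` and every reduced separated `k`-scheme `X` of
finite type with only FINITELY MANY non-regular points, `X` has a resolution of singularities
`Scheme.HasResolution X` — proper, birational over a dense open with dense preimage, regular source),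
filed by the birth-vetting refuter (crux-attack, 2026-08-17). This file declares NO definition: the
variant statement is written out inline, and NO declaration concludes the route decl positively.

* `isolatedResolution_false_without_isReduced` — with the hypothesis `IsReduced X` dropped (all other
  hypotheses, INCLUDING the finiteness of the non-regular locus, kept) the statement is FALSE: the
  witness is `X = Spec 𝔽₂[ε] → Spec 𝔽₂` (affine, hence separated and quasi-compact; of finite type;
  its underlying space is finite — `𝔽₂[ε]` is Artinian — so the non-regular locus is trivially finite),
  which has no resolution at all (`not_hasResolution_spec_dualNumber`, Literature: a dense open of the
  one-point space is everything, the resolution restricts to an isomorphism over it, so `𝔽₂[ε]` would be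
  a regular local ring, hence a domain). Consequences recorded for provers/planners: (i) `IsReduced X` is
  load-bearing in K exactly as in the summit; (ii) the extra finiteness hypothesis of K opens NO junk
  route to `Scheme.HasResolution` — the conclusion is not satisfiable by degenerate sources even on
  one-point schemes, so K is a faithful (non-vacuous, non-trivial) special case of the summit.

## Sources
* H. Matsumura, *Commutative Ring Theory*, CUP 1986, Thm. 14.3 (regular local rings are domains), as
  proved in the tree (`isDomain_of_isRegularLocalRing`).
* The Stacks Project, Tags 01RN (birational morphisms), 02IS (regular schemes).
-/

noncomputable section

set_option linter.dupNamespace false -- mandated namespace of this single-conjunct summit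

open CategoryTheory AlgebraicGeometry
open Literature.AlgebraicGeometry.Resolution

namespace Summit.ResolutionOfSingularities.ResolutionOfSingularities.Theorems.IsolatedResolution.Negative

/-- **Reducedness is load-bearing in `IsolatedResolution`.** The crux K with `IsReduced X` dropped —
"every separated finite-type `X/k`, `char k = p`, with finitely many non-regular points has a
resolution" — is false: `p = 2`, `k = 𝔽₂`, `X = Spec 𝔽₂[ε]` (one point, non-reduced; the non-regular
locus is finite because the whole space is) admits no proper birational morphism from a regular scheme
(`not_hasResolution_spec_dualNumber`). [folklore] -/
theorem isolatedResolution_false_without_isReduced :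
    ¬ (∀ p : ℕ, p.Prime → ∀ (k : Type) [Field k] [CharP k p] (X : Scheme.{0})
        (f : X ⟶ Spec (.of k)), IsSeparated f → LocallyOfFiniteType f → QuasiCompact f →
        {x : X | ¬ IsRegularLocalRing (X.presheaf.stalk x)}.Finite → Scheme.HasResolution X) := by
  intro h
  haveI : Module.Finite (ZMod 2) (DualNumber (ZMod 2)) :=
    inferInstanceAs (Module.Finite (ZMod 2) (ZMod 2 × ZMod 2))
  haveI : IsArtinianRing (DualNumber (ZMod 2)) := IsArtinianRing.of_finite (ZMod 2) _
  haveI : Finite (Spec (.of (DualNumber (ZMod 2)))) :=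
    inferInstanceAs (Finite (PrimeSpectrum (DualNumber (ZMod 2))))
  let f : Spec (.of (DualNumber (ZMod 2))) ⟶ Spec (.of (ZMod 2)) :=
    Spec.map (CommRingCat.ofHom (algebraMap (ZMod 2) (DualNumber (ZMod 2))))
  haveI : LocallyOfFiniteType f :=
    (HasRingHomProperty.Spec_iff (P := @LocallyOfFiniteType)).mpr
      (RingHom.finiteType_algebraMap.mpr inferInstance)
  exact not_hasResolution_spec_dualNumber (ZMod 2)
    (h 2 Nat.prime_two (ZMod 2) (Spec (.of (DualNumber (ZMod 2)))) f inferInstance inferInstance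
      inferInstance (Set.toFinite _))

end Summit.ResolutionOfSingularities.ResolutionOfSingularities.Theorems.IsolatedResolution.Negative

end
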